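import Summits.AtomisticToContinuum.BoseEinsteinCondensation.Theorems.BECStronglyRayleighInsertionFieldDelocalisationLinearVoidTailPrelim
import Summits.AtomisticToContinuum.BoseEinsteinCondensation.Theorems.BECStronglyRayleighInsertionFieldDelocalisationNACeilingPinned
import Summits.AtomisticToContinuum.BoseEinsteinCondensation.Theorems.InsertionFieldDelocalisation.Negative.Tightness
import Summits.AtomisticToContinuum.BoseEinsteinCondensation.Theorems.InsertionFieldDelocalisation.Negative.PerronExistence
import HarnessLib

/-!
# The negative-dependence ceiling: the crux inequality holds with `M = N`
# (crux `BECStronglyRayleigh.InsertionFieldDelocalisation`, stmt-AtomisticToContinuum-9673)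

What the route's structural engine (Theorem S, `GroundStateStability_proof`: the occupation
amplitudes `a(S) = Re ψ(1_S)` of an admissible datum have a real stable generating polynomial)
gives towards the crux, with nothing held back: the CONDITIONAL ONE-POINT CEILING

  `Σ_{S ⊇ T ∪ {x}} a(S) · L³ ≤ N · Σ_{S ⊇ T} a(S)`   for every background `T` and site `x ∉ T`

(`naCeiling_pinned`; i.e. `P_a(x ∈ S | T ⊆ S) ≤ N / L³`: pinning particles only lowers the
occupation probability elsewhere — iterated pairwise negative correlation of the pinned
families, which stay "stable or zero", started from the exact value `N / L³` at `T = ∅` given by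
translation invariance), hence the pointwise flatness bound on the insertion field

  `2 · L³ · r^T_x ≤ N · Σ_y r^T_y`                    (`naCeiling_field`)

and therefore the crux inequality with the `N`-DEPENDENT constant `M = N`
(`naCeiling : … → K1Ineq N L N ψ`). The crux asks for `M` independent of `N`; the factor `N`
between the two is two-particle delocalisation given the background (ODLRO), which no
negative-dependence argument supplies (see the lead's report and `MottProximity.md` on the
crux item: within the strongly Rayleigh class the ceiling `M = N` is attained up to a constant).
-/

noncomputable section

namespace Summit.AtomisticToContinuum.BoseEinsteinCondensation.Cruxes.InsertionFieldDelocalisation.MobileTrapDirichletEigenfunction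

open scoped BigOperators
open Literature.MathematicalPhysics.QuantumLattice Literature.Probability.LatticeModels Finset
open Summit.AtomisticToContinuum.BoseEinsteinCondensation.Theorems.InsertionFieldDelocalisation.Negative

/-! ### The torus: ceiling, pointwise field bound, and the crux with `M = N` -/
section Torus

/-- **The conditional one-point ceiling** for an admissible datum of the crux: for every
background `T` and every site `x ∉ T`,
`(Σ_{S ⊇ T ∪ {x}} Re ψ(1_S)) · L³ ≤ N · Σ_{S ⊇ T} Re ψ(1_S)`. [folklore] -/
theorem naCeiling_pinned (L : ℕ) [NeZero L] (hL : 2 ≤ L) {N : ℕ} (hN : 2 ≤ N) (hNL : 2 * N ≤ L ^ 3)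
    {ψ : TensorIndex (TorusSite 3 L) 2 → ℂ}
    (hψK : ψ ∈ spinZSector 1 ((N : ℝ) - (L : ℝ) ^ 3 / 2)) (hψ0 : ψ ≠ 0)
    (hH : (xyTorus 3 L 1).mulVec ψ =
      ((lowestEnergyInSector 1 (xyTorus 3 L 1) ((N : ℝ) - (L : ℝ) ^ 3 / 2) : ℝ) : ℂ) • ψ)
    (hnn : ∀ σ, 0 ≤ (ψ σ).re ∧ (ψ σ).im = 0) (T : Finset (TorusSite 3 L)) (x : TorusSite 3 L)
    (hx : x ∉ T) :
    (∑ S ∈ univ.filter (fun S : Finset (TorusSite 3 L) => insert x T ⊆ S),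
        (ψ (fun i => if i ∈ S then 0 else 1)).re) * (L : ℝ) ^ 3 ≤
      N * ∑ S ∈ univ.filter (fun S : Finset (TorusSite 3 L) => T ⊆ S),
        (ψ (fun i => if i ∈ S then 0 else 1)).re := by
  set a : Finset (TorusSite 3 L) → ℝ := fun S => (ψ (fun i => if i ∈ S then 0 else 1)).re with ha
  have ha0 : ∀ S, 0 ≤ a S := fun S => (hnn _).1
  have hsupp : ∀ S, a S ≠ 0 → S.card = N := by
    intro S hS
    have hS' : ψ (fun i => if i ∈ S then 0 else 1) ≠ 0 := by
      intro h
      apply hS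
      simp only [ha, h, Complex.zero_re]
    have hmag := (LiebMattis.mem_spinZSector_iff 1 ((N : ℝ) - (L : ℝ) ^ 3 / 2) ψ).mp hψK _ hS'
    rw [magnetisation_ind, card_torusSite] at hmag
    have h : (S.card : ℂ) = (N : ℂ) := by
      have h2 : ((L : ℝ) : ℂ) ^ 3 = ((L ^ 3 : ℕ) : ℂ) := by push_cast; ring
      have := hmag
      push_cast at this ⊢
      linear_combination this
    exact_mod_cast h
  have hstab : (∀ S, a S = 0) ∨ ∀ z : TorusSite 3 L → ℂ, (∀ i, 0 < (z i).im) →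
      (∑ S : Finset (TorusSite 3 L), (a S : ℂ) * ∏ i ∈ S, z i) ≠ 0 :=
    Or.inr (lvt_amplitudes_stable L hψK hψ0 hH hnn)
  have hV : Fintype.card (TorusSite 3 L) = L ^ 3 := card_torusSite 3 L
  -- the base case `A({x})·L³ = N·A(∅)` from translation invariance and double counting
  have hbase : ∀ y : TorusSite 3 L,
      (∑ S ∈ univ.filter (fun S : Finset (TorusSite 3 L) => ({y} : Finset _) ⊆ S), a S) * (L : ℝ) ^ 3 =
        N * ∑ S : Finset (TorusSite 3 L), a S := by
    intro y
    have hfy : (univ.filter fun S : Finset (TorusSite 3 L) => ({y} : Finset _) ⊆ S) =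
        univ.filter fun S : Finset (TorusSite 3 L) => y ∈ S := by
      ext S; simp
    rw [hfy]
    have h1 : ∑ b : TorusSite 3 L, ∑ S ∈ univ.filter (fun S : Finset (TorusSite 3 L) => b ∈ S), a S =
        (Fintype.card (TorusSite 3 L) : ℝ) *
          ∑ S ∈ univ.filter (fun S : Finset (TorusSite 3 L) => y ∈ S), a S := by
      rw [Finset.sum_congr rfl fun b _ => lvt_onePoint_const L hL hN hNL hψK hψ0 hH hnn b y,
        Finset.sum_const, nsmul_eq_mul, Finset.card_univ]
    have h2 := lvt_sum_sum_mem a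
    rw [lvt_sum_card_mul a N hsupp, h1, hV] at h2
    push_cast at h2
    linarith
  exact nac_ceiling_induction a ha0 hstab ((L : ℝ) ^ 3) N (Nat.cast_nonneg N) hbase T x hx

/-- **Pointwise flatness of the insertion field at the filling scale**: for an admissible
datum of the crux, every background `T` with `#T = N - 2` and every site `x`,
`2 · L³ · r^T_x ≤ N · Σ_y r^T_y`. [folklore] -/
theorem naCeiling_field (L : ℕ) [NeZero L] (hL : 2 ≤ L) {N : ℕ} (hN : 2 ≤ N) (hNL : 2 * N ≤ L ^ 3)
    {ψ : TensorIndex (TorusSite 3 L) 2 → ℂ}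
    (hψK : ψ ∈ spinZSector 1 ((N : ℝ) - (L : ℝ) ^ 3 / 2)) (hψ0 : ψ ≠ 0)
    (hH : (xyTorus 3 L 1).mulVec ψ =
      ((lowestEnergyInSector 1 (xyTorus 3 L 1) ((N : ℝ) - (L : ℝ) ^ 3 / 2) : ℝ) : ℂ) • ψ)
    (hnn : ∀ σ, 0 ≤ (ψ σ).re ∧ (ψ σ).im = 0) {T : Finset (TorusSite 3 L)} (hT : T.card = N - 2)
    (x : TorusSite 3 L) :
    2 * (L : ℝ) ^ 3 * field ψ T x ≤ N * ∑ y, field ψ T y := by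
  set a : Finset (TorusSite 3 L) → ℝ := fun S => (ψ (fun i => if i ∈ S then 0 else 1)).re with ha
  have ha0 : ∀ S, 0 ≤ a S := fun S => (hnn _).1
  have hsupp : ∀ S, a S ≠ 0 → S.card = N := by
    intro S hS
    have hS' : ψ (fun i => if i ∈ S then 0 else 1) ≠ 0 := by
      intro h
      apply hS
      simp only [ha, h, Complex.zero_re]
    have hmag := (LiebMattis.mem_spinZSector_iff 1 ((N : ℝ) - (L : ℝ) ^ 3 / 2) ψ).mp hψK _ hS'
    rw [magnetisation_ind, card_torusSite] at hmag
    have h : (S.card : ℂ) = (N : ℂ) := by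
      have h2 : ((L : ℝ) : ℂ) ^ 3 = ((L ^ 3 : ℕ) : ℂ) := by push_cast; ring
      have := hmag
      push_cast at this ⊢
      linear_combination this
    exact_mod_cast h
  have hT2 : T.card + 2 = N := by omega
  -- the field above `T` in superset form
  have hfield : ∀ y : TorusSite 3 L, field ψ T y =
      if y ∈ T then 0 else ∑ S ∈ univ.filter (fun S : Finset (TorusSite 3 L) => insert y T ⊆ S), a S := by
    intro y
    by_cases hy : y ∈ T
    · rw [if_pos hy]
      unfold field
      exact Finset.sum_eq_zero fun y' _ => if_neg fun h => h.1 hy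
    · rw [if_neg hy]
      have hU : (insert y T).card + 1 = N := by rw [card_insert_of_notMem hy]; omega
      rw [nac_superset_sum_eq_insert a N hsupp hU]
      unfold field
      refine Finset.sum_congr rfl fun y' _ => ?_
      by_cases h : y ∉ T ∧ y' ∉ T ∧ y ≠ y'
      · have h' : y' ∉ insert y T := by
          rw [mem_insert, not_or]; exact ⟨fun e => h.2.2 e.symm, h.2.1⟩
        rw [if_pos h, if_neg h', Finset.insert_comm]
      · have h' : y' ∈ insert y T := by
          rw [mem_insert]
          by_contra hc
          rw [not_or] at hc
          exact h ⟨hy, hc.2, fun e => hc.1 e.symm⟩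
        rw [if_neg h, if_pos h']
  have hfield_nn : ∀ y, 0 ≤ field ψ T y := by
    intro y; rw [hfield y]
    split_ifs
    · exact le_rfl
    · exact Finset.sum_nonneg fun S _ => ha0 S
  have hsum : ∑ y, field ψ T y = 2 * ∑ S ∈ univ.filter (fun S : Finset (TorusSite 3 L) => T ⊆ S), a S := by
    rw [Finset.sum_congr rfl fun y _ => hfield y]
    exact nac_sum_superset_insert a N hsupp hT2
  by_cases hx : x ∈ T
  · have : field ψ T x = 0 := by rw [hfield x, if_pos hx]
    rw [this, mul_zero]
    exact mul_nonneg (Nat.cast_nonneg N) (Finset.sum_nonneg fun y _ => hfield_nn y)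
  · rw [hfield x, if_neg hx, hsum]
    have key := naCeiling_pinned L hL hN hNL hψK hψ0 hH hnn T x hx
    nlinarith [key]

/-- **The negative-dependence ceiling**: the crux inequality holds with the `N`-dependent
constant `M = N`, for every admissible datum (registered handle, stub form,
`--supports stmt-AtomisticToContinuum-9673`). -/
theorem naCeiling :
    ∀ (L : ℕ) [NeZero L], 2 ≤ L → ∀ N : ℕ, 2 ≤ N → 2 * N ≤ L ^ 3 →
      ∀ ψ : TensorIndex (TorusSite 3 L) 2 → ℂ,
        ψ ∈ spinZSector 1 ((N : ℝ) - (L : ℝ) ^ 3 / 2) → ψ ≠ 0 →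
        (xyTorus 3 L 1).mulVec ψ =
          ((lowestEnergyInSector 1 (xyTorus 3 L 1) ((N : ℝ) - (L : ℝ) ^ 3 / 2) : ℝ) : ℂ) • ψ →
        (∀ σ, 0 ≤ (ψ σ).re ∧ (ψ σ).im = 0) → K1Ineq (N : ℝ) L N ψ := by
  intro L _ hL N hN hNL ψ hψK hψ0 hH hnn
  unfold K1Ineq
  rw [Finset.mul_sum, Finset.mul_sum]
  refine Finset.sum_le_sum fun T hT => ?_
  rw [mem_powersetCard] at hT
  have hfield_nn : ∀ y, 0 ≤ field ψ T y := by
    intro y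
    unfold field
    refine Finset.sum_nonneg fun y' _ => ?_
    split_ifs
    · exact (hnn _).1
    · exact le_rfl
  exact nac_K1lhs_le (field ψ T) hfield_nn ((L : ℝ) ^ 3) N (Nat.cast_nonneg N)
    fun x => naCeiling_field L hL hN hNL hψK hψ0 hH hnn hT.2 x

/-- **Corollary**: the crux at the fixed constant `M` holds for all data with `N ≤ M`
(`InsertionFieldDelocalisationAt`-style, few-body regime). -/
theorem naCeiling_K1Ineq_of_le (M : ℝ) (L : ℕ) [NeZero L] (hL : 2 ≤ L) (N : ℕ) (hN : 2 ≤ N)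
    (hNL : 2 * N ≤ L ^ 3) (hNM : (N : ℝ) ≤ M) (ψ : TensorIndex (TorusSite 3 L) 2 → ℂ)
    (hψK : ψ ∈ spinZSector 1 ((N : ℝ) - (L : ℝ) ^ 3 / 2)) (hψ0 : ψ ≠ 0)
    (hH : (xyTorus 3 L 1).mulVec ψ =
      ((lowestEnergyInSector 1 (xyTorus 3 L 1) ((N : ℝ) - (L : ℝ) ^ 3 / 2) : ℝ) : ℂ) • ψ)
    (hnn : ∀ σ, 0 ≤ (ψ σ).re ∧ (ψ σ).im = 0) : K1Ineq M L N ψ := by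
  have h := naCeiling L hL N hN hNL ψ hψK hψ0 hH hnn
  unfold K1Ineq at h ⊢
  refine h.trans (mul_le_mul_of_nonneg_right hNM (Finset.sum_nonneg fun T _ => ?_))
  unfold K1rhs
  exact Finset.sum_nonneg fun y _ => by positivity

/-- **Supersets of a full `N`-set**: for a family supported on `N`-sets and `#U = N`,
`Σ_{S ⊇ U} a(S) = a(U)`. [folklore] -/
theorem nac_superset_sum_eq_self {Λ : Type*} [Fintype Λ] [DecidableEq Λ] (a : Finset Λ → ℝ) (N : ℕ)
    (ha : ∀ S, a S ≠ 0 → S.card = N) {U : Finset Λ} (hU : U.card = N) :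
    ∑ S ∈ univ.filter (fun S : Finset Λ => U ⊆ S), a S = a U := by
  refine Finset.sum_eq_single_of_mem U (by simp) fun S hS hSU => ?_
  simp only [mem_filter, mem_univ, true_and] at hS
  by_contra hne
  exact hSU (eq_of_subset_of_card_le hS (by rw [ha S hne, hU])).symm

/-- **The one-particle negative-dependence ceiling**: for an admissible datum of the crux, the
ONE-particle insertion field `u^T_x = [x ∉ T] Re ψ(1_{T ∪ {x}})` above an `(N-1)`-set `T`
satisfies `L³ · u^T_x ≤ N · Σ_y u^T_y` pointwise, hence the one-particle flatness inequality of
the Penrose–Onsager line holds with the `N`-dependent constant `2N`. [folklore] -/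
theorem naCeiling_one :
    ∀ (L : ℕ) [NeZero L], 2 ≤ L → ∀ N : ℕ, 2 ≤ N → 2 * N ≤ L ^ 3 →
      ∀ ψ : TensorIndex (TorusSite 3 L) 2 → ℂ,
        ψ ∈ spinZSector 1 ((N : ℝ) - (L : ℝ) ^ 3 / 2) → ψ ≠ 0 →
        (xyTorus 3 L 1).mulVec ψ =
          ((lowestEnergyInSector 1 (xyTorus 3 L 1) ((N : ℝ) - (L : ℝ) ^ 3 / 2) : ℝ) : ℂ) • ψ →
        (∀ σ, 0 ≤ (ψ σ).re ∧ (ψ σ).im = 0) →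
        (L : ℝ) ^ 3 * ∑ T ∈ (univ : Finset (TorusSite 3 L)).powersetCard (N - 1),
            K1lhs (fun x => if x ∉ T then (ψ (fun z => if z ∈ insert x T then 0 else 1)).re else 0) ≤
          (2 * N) * ∑ T ∈ (univ : Finset (TorusSite 3 L)).powersetCard (N - 1),
            K1rhs (fun x => if x ∉ T then (ψ (fun z => if z ∈ insert x T then 0 else 1)).re else 0) := by
  intro L _ hL N hN hNL ψ hψK hψ0 hH hnn
  set a : Finset (TorusSite 3 L) → ℝ := fun S => (ψ (fun i => if i ∈ S then 0 else 1)).re with ha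
  have ha0 : ∀ S, 0 ≤ a S := fun S => (hnn _).1
  have hsupp : ∀ S, a S ≠ 0 → S.card = N := by
    intro S hS
    have hS' : ψ (fun i => if i ∈ S then 0 else 1) ≠ 0 := by
      intro h
      apply hS
      simp only [ha, h, Complex.zero_re]
    have hmag := (LiebMattis.mem_spinZSector_iff 1 ((N : ℝ) - (L : ℝ) ^ 3 / 2) ψ).mp hψK _ hS'
    rw [magnetisation_ind, card_torusSite] at hmag
    have h : (S.card : ℂ) = (N : ℂ) := by
      have h2 : ((L : ℝ) : ℂ) ^ 3 = ((L ^ 3 : ℕ) : ℂ) := by push_cast; ring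
      have := hmag
      push_cast at this ⊢
      linear_combination this
    exact_mod_cast h
  rw [Finset.mul_sum, Finset.mul_sum]
  refine Finset.sum_le_sum fun T hT => ?_
  rw [mem_powersetCard] at hT
  have hT1 : T.card + 1 = N := by omega
  -- the one-particle field above `T` and its total
  have hu : ∀ x, (if x ∉ T then (ψ (fun z => if z ∈ insert x T then 0 else 1)).re else 0) =
      if x ∈ T then 0 else a (insert x T) := by
    intro x
    by_cases hx : x ∈ T
    · rw [if_neg (not_not_intro hx), if_pos hx]
    · rw [if_pos hx, if_neg hx]
  have hu0 : ∀ x, 0 ≤ (if x ∉ T then (ψ (fun z => if z ∈ insert x T then 0 else 1)).re else 0) := by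
    intro x; rw [hu x]
    split_ifs
    · exact le_rfl
    · exact ha0 _
  have htot : ∑ y, (if y ∉ T then (ψ (fun z => if z ∈ insert y T then 0 else 1)).re else 0) =
      ∑ S ∈ univ.filter (fun S : Finset (TorusSite 3 L) => T ⊆ S), a S := by
    rw [nac_superset_sum_eq_insert a N hsupp hT1]
    exact Finset.sum_congr rfl fun y _ => hu y
  have key := nac_K1lhs_le _ hu0 ((L : ℝ) ^ 3 / 2) N (Nat.cast_nonneg N) fun x => by
    rw [htot, hu x]
    by_cases hx : x ∈ T
    · rw [if_pos hx, mul_zero]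
      exact mul_nonneg (Nat.cast_nonneg N) (Finset.sum_nonneg fun S _ => ha0 S)
    · rw [if_neg hx]
      have key := naCeiling_pinned L hL hN hNL hψK hψ0 hH hnn T x hx
      rw [nac_superset_sum_eq_self a N hsupp (by rw [card_insert_of_notMem hx]; omega)] at key
      linarith [key]
  linarith [key]

end Torus

end Summit.AtomisticToContinuum.BoseEinsteinCondensation.Cruxes.InsertionFieldDelocalisation.MobileTrapDirichletEigenfunction

end
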